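import Literature.Computability.QuantumComplexity.MatchgateHeisenberg
import Literature.Computability.QuantumComplexity.MatchgateMachine
import Literature.Computability.Cryptography.QuantumCircuitDescFP
import Literature.Computability.Complexity.CodeFPOfUnary
import Literature.Computability.Cryptography.PolyTimeComputableRealsSqrt
import HarnessLib

/-!
# Discharge of `JozsaMiyake2008_thm1`: nearest-neighbour matchgate circuits are classically simulable

Topic `Literature/Computability/QuantumComplexity`, model namespace `Matchgate`. Last proof file of
the discharge of the named fact `JozsaMiyake2008_thm1` (`MatchgateSimulation.lean`), assembling
parts I–IV (`MatchgateCliffordAlgebra`, `MatchgateHeisenberg`, `MatchgateNumerics`,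
`MatchgateMachine`):

* **effectivity** (the hypothesis made explicit in the fact): the sixteen entries of the `SO(4)`
  block `rotOf U` of a two-qubit gate with polynomial-time computable entries are polynomial-time
  computable reals (`ptcReal_rotOf`, a private copy of `isPolyTimeComputableReal_rotOf`, whose public version lives
  in the sibling `MatchgateEstimatorFP.lean` — an independent fixed-point machine for the same
  fact, not imported here; from the ring closure of `IsPolyTimeComputableComplex`, Ko 1991 /
  Bernstein–Vazirani 1997 §6);
* **the table** `lookOf`: symbol code, orientation, precision `P ↦` the `2^{-P}`-accurate dyadic
  approximations `f(P)/2^P` of the block of the (possibly wire-exchanged) gate, read off the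
  polynomial-time NAMES of these reals; it is computed on codes (`lookFP_lookOf`, a finite case
  analysis over the alphabet) and dyadically bounded (`lookBound_lookOf`);
* **correctness**: on a nearest-neighbour instance the machine's rows lay out the approximate row
  folds of part III attached to the exact rows `rowVec` of part II (`represents_rows`,
  `exactFold_eq_rowVec`, `goodSteps_steps`), so `|Z̃ - ⟨Z₀⟩| ≤ 24T/2^{k+T+8} ≤ 2^{-(k+1)}` and the
  rounded estimate is a `2^{-k}`-approximation of `p₁ = (1 - ⟨Z₀⟩)/2` (`acceptProb_eq`);
* **`JozsaMiyake2008_thm1_holds`**.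

## References

* R. Jozsa, A. Miyake, *Matchgates and classical simulation of quantum circuits*, Proc. R. Soc. A
  464 (2008) 3089–3106 = arXiv:0804.4050, Thm. 1 (p. 3), §4 (Thm. 3, eq. (8), (10)), §5.
  [JozsaMiyake2008]
* K.-I. Ko, *Complexity Theory of Real Functions*, Birkhäuser 1991, §2.1–2.2. [Ko1991]
* E. Bernstein, U. Vazirani, *Quantum complexity theory*, SIAM J. Comput. 26 (1997), §6.
  [BernsteinVazirani1997]
-/

namespace Literature.Computability.QuantumComplexity.Matchgate

open _root_.Computability Literature.Computability.Complexity Literature.Computability.Complexity.CodeFP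
  Literature.Computability.Cryptography Matrix Complex Finset
open Literature.Algebra.EuclideanLattices (encodeRat encodeRat_injective)

/-! ### Effectivity of the rotation entries -/

section effectivity

/-- Entries of a product of `2 × 2` matrices with polynomial-time computable entries. [cite: Ko1991, §2.2] -/
private theorem ptc_mul_apply {A B : Matrix (Fin 2) (Fin 2) ℂ} (hA : ∀ i j, IsPolyTimeComputableComplex (A i j))
    (hB : ∀ i j, IsPolyTimeComputableComplex (B i j)) (i j : Fin 2) : IsPolyTimeComputableComplex ((A * B) i j) := by
  rw [Matrix.mul_apply, Fin.sum_univ_two]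
  exact ((hA i 0).mul (hB 0 j)).add ((hA i 1).mul (hB 1 j))

/-- Entries of the conjugate transpose. [cite: Ko1991, §2.2] -/
private theorem ptc_conjTranspose_apply {A : Matrix (Fin 2) (Fin 2) ℂ} (hA : ∀ i j, IsPolyTimeComputableComplex (A i j))
    (i j : Fin 2) : IsPolyTimeComputableComplex (Aᴴ i j) := by
  rw [conjTranspose_apply, Complex.star_def]
  exact (hA j i).conj

/-- The entries `0, ±1, ±i` of the four matrices are polynomial-time computable. [cite: Ko1991, §2.1] -/
private theorem ptc_pauli (p : LIdx) (i j : Fin 2) : IsPolyTimeComputableComplex (pauli p i j) := by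
  have h0 := isPolyTimeComputableComplex_zero
  have h1 := isPolyTimeComputableComplex_one
  have hI := isPolyTimeComputableComplex_I
  rcases lIdx_cases p with rfl | rfl | rfl | rfl <;> fin_cases i <;> fin_cases j <;>
    simp [pauli, h0, h1, hI, h1.neg, hI.neg]

/-- `2⁻¹` is polynomial-time computable. [cite: Ko1991, §2.1] -/
private theorem ptc_half : IsPolyTimeComputableComplex (2⁻¹ : ℂ) := by
  have := IsPolyTimeComputableComplex.ofReal (IsPolyTimeComputableReal.ratCast' (1 / 2))
  convert this using 1
  push_cast
  norm_num

/-- **The `SO(4)` block of a two-qubit gate with polynomial-time computable entries has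
polynomial-time computable entries** — the effectivity behind "the full matrix `R` is poly-time
computable" (JM08 §4) once gate entries are only assumed polynomial-time computable. [cite: JozsaMiyake2008, §4 (after eq. (8))] -/
private theorem ptcReal_rotOf {U : Matrix (QReg 2) (QReg 2) ℂ}
    (hU : ∀ u v, IsPolyTimeComputableComplex (U u v)) (μ ν : LIdx) : IsPolyTimeComputableReal (rotOf U μ ν) := by
  have hA : ∀ i j, IsPolyTimeComputableComplex (evenBlock U i j) := fun i j => hU _ _
  have hB : ∀ i j, IsPolyTimeComputableComplex (oddBlock U i j) := fun i j => hU _ _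
  have hM : ∀ i j, IsPolyTimeComputableComplex (((evenBlock U)ᴴ * pauli μ * oddBlock U * (pauli ν)ᴴ) i j) :=
    ptc_mul_apply (ptc_mul_apply (ptc_mul_apply (ptc_conjTranspose_apply hA) (ptc_pauli μ)) hB)
      (ptc_conjTranspose_apply (ptc_pauli ν))
  have hz : IsPolyTimeComputableComplex (coef ((evenBlock U)ᴴ * pauli μ * oddBlock U) ν) := by
    rw [coef, trace_fin_two, div_eq_mul_inv]
    exact ((hM 0 0).add (hM 1 1)).mul ptc_half
  exact hz.1

end effectivity

/-! ### The table of dyadic block approximations -/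

section table

variable {Op : Type} {M : Op → Matrix (QReg 2) (QReg 2) ℂ}

/-- The wire list `[e 0, e 1]` of a two-wire embedding. [folklore] -/
def wiresOf {N : ℕ} (e : Fin 2 ↪ Fin N) : List ℕ := [((e 0 : Fin N) : ℕ), ((e 1 : Fin N) : ℕ)]

/-- The orientation bit of a two-wire embedding: `true` iff the wires are in backward order. [folklore] -/
def orBit {N : ℕ} (e : Fin 2 ↪ Fin N) : Bool := decide (((e 1 : Fin N) : ℕ) + 1 = e 0)

/-- The local gate of a symbol in a given orientation (`true` = wires exchanged). [cite: JozsaMiyake2008, §2] -/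
noncomputable def locGate (M : Op → Matrix (QReg 2) (QReg 2) ℂ) (g : Op) (o : Bool) : Matrix (QReg 2) (QReg 2) ℂ :=
  if o then (M g).submatrix (fun x => x ∘ wireSwap) (fun x => x ∘ wireSwap) else M g

/-- `localGate` of part II is `locGate` at the orientation bit `orD`. [folklore] -/
theorem localGate_eq_locGate {N : ℕ} (g : Op) {e : Fin 2 ↪ Fin N} (h : IsAdj e) :
    localGate (M g) e = locGate M g (orBit e) := by
  unfold localGate locGate orBit
  by_cases hf : ((e 0 : Fin N) : ℕ) + 1 = e 1
  · have hb : ¬ (((e 1 : Fin N) : ℕ) + 1 = e 0) := by omega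
    simp [hf, hb]
  · have hb : ((e 1 : Fin N) : ℕ) + 1 = e 0 := h.resolve_left hf
    simp [hf, hb]

/-- Local gates of allowable matchgates are allowable matchgates. [cite: JozsaMiyake2008, §2] -/
theorem isMatchgate_locGate (hM : ∀ g, IsMatchgate (M g)) (g : Op) (o : Bool) : IsMatchgate (locGate M g o) := by
  unfold locGate; split_ifs
  · exact (hM g).submatrix_swap
  · exact hM g

/-- Entries of local gates are polynomial-time computable when the gate entries are. [cite: Ko1991, §2.1] -/
theorem ptc_locGate (hE : ∀ g u v, IsPolyTimeComputableComplex (M g u v)) (g : Op) (o : Bool) (u v : QReg 2) :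
    IsPolyTimeComputableComplex (locGate M g o u v) := by
  unfold locGate; split_ifs
  · exact hE g _ _
  · exact hE g u v

/-- A **name system** for the rotation entries: dyadic names `f(P)/2^P`, each computable in
polynomial time from `1^P`, of every entry of every block of every symbol in both orientations.
[cite: Ko1991, §2.1 (Def. 2.1)] -/
structure Names (M : Op → Matrix (QReg 2) (QReg 2) ℂ) where
  /-- The name of the entry `(μ, ν)` of the block of symbol `g` in orientation `o`. -/
  f : Op → Bool → LIdx → LIdx → ℕ → ℤ
  /-- Each name is polynomial-time computable from the unary precision. -/
  poly : ∀ g o μ ν, PolyTimeComputable unaryEncodeNat encodingIntBool.encode (f g o μ ν)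
  /-- Each name is `2^{-P}`-accurate. -/
  close : ∀ g o μ ν P, |rotOf (locGate M g o) μ ν - (f g o μ ν P : ℝ) / 2 ^ P| ≤ (1 / 2 : ℝ) ^ P

/-- **Names exist** when the gate entries are polynomial-time computable. [cite: JozsaMiyake2008, §4; Ko1991, §2.2] -/
theorem nonempty_names (hE : ∀ g u v, IsPolyTimeComputableComplex (M g u v)) : Nonempty (Names M) := by
  have h : ∀ g o μ ν, IsPolyTimeComputableReal (rotOf (locGate M g o) μ ν) := fun g o μ ν =>
    ptcReal_rotOf (ptc_locGate hE g o) μ ν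
  choose f hf using h
  exact ⟨⟨f, fun g o μ ν => (hf g o μ ν).1, fun g o μ ν => (hf g o μ ν).2⟩⟩

section encodable

variable [Encodable Op]

/-- **The table of block approximations** read off a name system: for a symbol code `c`,
orientation `o` and precision `P`, the matrix of `f(P)/2^P`; the zero matrix for non-codes.
[cite: JozsaMiyake2008, §4] -/
noncomputable def lookOf (nm : Names M) (c : ℕ) (o : Bool) (P : ℕ) : Matrix LIdx LIdx ℚ :=
  match Encodable.decode₂ Op c with
  | some g => Matrix.of fun μ ν => (nm.f g o μ ν P : ℚ) / 2 ^ P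
  | none => 0

/-- The table on a genuine symbol code. [folklore] -/
theorem lookOf_encode (nm : Names M) (g : Op) (o : Bool) (P : ℕ) (μ ν : LIdx) :
    lookOf nm (Encodable.encode g) o P μ ν = (nm.f g o μ ν P : ℚ) / 2 ^ P := by
  rw [lookOf, Encodable.decode₂_encode]; rfl

/-- The table off the symbol codes. [folklore] -/
theorem lookOf_of_ne (nm : Names M) {c : ℕ} (hc : ∀ g : Op, Encodable.encode g ≠ c) (o : Bool) (P : ℕ) (μ ν : LIdx) :
    lookOf nm c o P μ ν = 0 := by
  rw [lookOf]
  cases h : Encodable.decode₂ Op c with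
  | none => rfl
  | some g => exact absurd (Encodable.decode₂_eq_some.1 h) (hc g)

/-- **The table is dyadically bounded**: entries `m/2^P` of absolute value at most `2` (the exact
entries are at most `1`, rows of an orthogonal matrix). [folklore] -/
theorem lookBound_lookOf (hM : ∀ g, IsMatchgate (M g)) (nm : Names M) : LookBound (lookOf nm) := by
  intro c o P μ ν
  by_cases hc : ∃ g : Op, Encodable.encode g = c
  · obtain ⟨g, rfl⟩ := hc
    rw [lookOf_encode]
    refine ⟨⟨nm.f g o μ ν P, rfl⟩, ?_⟩
    have h1 := nm.close g o μ ν P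
    have h2 := (isMatchgate_locGate hM g o).abs_rotOf_le_one μ ν
    have h3 : ((1 / 2 : ℝ)) ^ P ≤ 1 := pow_le_one₀ (by norm_num) (by norm_num)
    have h4 : |((nm.f g o μ ν P : ℝ)) / 2 ^ P| ≤ 2 := by
      have := abs_sub_abs_le_abs_sub ((nm.f g o μ ν P : ℝ) / 2 ^ P) (rotOf (locGate M g o) μ ν)
      rw [abs_sub_comm] at h1
      linarith
    have hcast : (((nm.f g o μ ν P : ℚ) / 2 ^ P : ℚ) : ℝ) = (nm.f g o μ ν P : ℝ) / 2 ^ P := by push_cast; ring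
    exact_mod_cast (show |(((nm.f g o μ ν P : ℚ) / 2 ^ P : ℚ) : ℝ)| ≤ 2 by rw [hcast]; exact h4)
  · push Not at hc
    rw [lookOf_of_ne nm hc]
    exact ⟨IsDy.zero _, by norm_num⟩

/-- One dyadic name as a rational function of the unary precision is computed on codes. [cite: AroraBarak2009, §1.3] -/
theorem codeFP_dyadicName {f : ℕ → ℤ} (hf : PolyTimeComputable unaryEncodeNat encodingIntBool.encode f) :
    CodeFP unE encodeRat (fun P => (f P : ℚ) / 2 ^ P) := by
  have h1 : CodeFP unE intE f := (intOfSM.comp (ofPolyTimeComputable_unE hf)).congr fun _ => rfl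
  have h2 : CodeFP unE natE (fun P => 2 ^ P) := (natPow.comp ((const _ 2).pair (CodeFP.id unE))).congr fun _ => rfl
  exact (ratOfIntNat.comp (h1.pair h2)).congr fun P => by push_cast; rfl

/-- A finite case analysis on symbol codes and the orientation bit. [cite: AroraBarak2009, §1.3] -/
theorem codeFP_symbolCases {F : ℕ → Bool → ℕ → ℚ} (hF : ∀ (g : Op) (o : Bool), CodeFP unE encodeRat (fun P => F (Encodable.encode g) o P))
    (l : List Op) :
    CodeFP (pairE natE (pairE bitE unE)) encodeRat
      (fun x => if x.1 ∈ l.map Encodable.encode then F x.1 x.2.1 x.2.2 else 0) := by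
  induction l with
  | nil => exact (const _ (0 : ℚ)).congr fun x => by simp
  | cons g l ih =>
    have htest : CodeFP (pairE natE (pairE bitE unE)) bitE (fun x => decide (x.1 = Encodable.encode g)) :=
      (natEq.comp ((fst _ _).pair (const _ (Encodable.encode g)))).congr fun _ => rfl
    have hbit : CodeFP (pairE natE (pairE bitE unE)) bitE (fun x => x.2.1) := (snd _ _).fst'
    have hg : CodeFP (pairE natE (pairE bitE unE)) encodeRat (fun x => F (Encodable.encode g) x.2.1 x.2.2) :=
      (hbit.ite ((hF g true).comp (snd _ _).snd') ((hF g false).comp (snd _ _).snd')).congr fun x => by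
        cases x.2.1 <;> rfl
    exact (htest.ite hg ih).congr fun x => by
      obtain ⟨c, o, P⟩ := x
      by_cases hc : c = Encodable.encode g
      · subst hc; simp
      · simp [hc, eq_comm]

/-- **The table is computed on codes.** [cite: AroraBarak2009, §1.3] -/
theorem lookFP_lookOf [Fintype Op] (nm : Names M) : LookFP (lookOf nm) := by
  intro μ ν
  have hF : ∀ (g : Op) (o : Bool), CodeFP unE encodeRat (fun P => lookOf nm (Encodable.encode g) o P μ ν) := fun g o =>
    (codeFP_dyadicName (nm.poly g o μ ν)).congr fun P => by rw [lookOf_encode]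
  refine (codeFP_symbolCases (F := fun c o P => lookOf nm c o P μ ν) hF Finset.univ.toList).congr fun x => ?_
  split_ifs with h
  · rfl
  · symm
    apply lookOf_of_ne
    intro g hg
    exact h (List.mem_map.2 ⟨g, Finset.mem_toList.2 (Finset.mem_univ g), hg⟩)

end encodable

end table

/-! ### The view of an instance and its code -/

section correctness

variable {Op : Type} [Encodable Op] {M : Op → Matrix (QReg 2) (QReg 2) ℂ}

/-- **The gate data of a placed gate** (its non-dependent shadow). [cite: AroraBarak2009, §6.1] -/
def gateDataOf {N : ℕ} : QGate (gateSet Op M) N → GateData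
  | .gate g e => (false, Encodable.encode g, wiresOf e)
  | .oracle k e => (true, k, List.ofFn fun j => ((e j : Fin N) : ℕ))

/-- **The code of the gate data of a placed gate is the tree's code of the gate.** [cite: AroraBarak2009, §6.1] -/
theorem gdE_gdOf {N : ℕ} (q : QGate (gateSet Op M) N) : gdE (gateDataOf q) = q.encode := by
  have hl : (encodingListNatBool.encode : List ℕ → List Bool) = listE natE := listE_eq encodingNatBool
  cases q with
  | gate g e =>
    show false :: boolPair (natE (Encodable.encode g)) (listE natE (wiresOf e)) =
      false :: boolPair (encodeNat (Encodable.encode g)) (encodingListNatBool.encode (List.ofFn fun i : Fin 2 => ((e i : Fin N) : ℕ)))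
    rw [hl, List.ofFn_succ, List.ofFn_succ, List.ofFn_zero]
    rfl
  | oracle k e =>
    show true :: boolPair (natE k) (listE natE (List.ofFn fun j => ((e j : Fin N) : ℕ))) =
      true :: boolPair (encodeNat k) (encodingListNatBool.encode (List.ofFn fun j => ((e j : Fin N) : ℕ)))
    rw [hl]

/-- **The view of an instance.** [cite: AroraBarak2009, §6.1] -/
def viewOf (i : Instance Op M) : View := ((i.n, i.m, i.circ.gates.map gateDataOf), (List.ofFn i.x, i.k))

/-- **The instance code is the code of its view.** [cite: AroraBarak2009, §6.1] -/
theorem encode_eq_viewE (i : Instance Op M) : i.encode = viewE (viewOf i) := by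
  obtain ⟨n, m, circ, x, k⟩ := i
  have hC : circ.encode = rawE gdE (circ.gates.map gateDataOf) := by
    rw [QCircuit.encode_eq_encList, rawE, List.map_map]
    congr 1
    exact List.map_congr_left fun q _ => (gdE_gdOf q).symm
  simp only [Instance.encode, viewOf, viewE, pairE_apply, QCircuit.sigmaEncode_eq, hC]
  rfl

/-! ### The machine's fold on a nearest-neighbour instance -/

omit [Encodable Op] in
/-- A nearest-neighbour gate is a gate symbol on a two-wire embedding (with the embedding typed
`Fin 2 ↪ Fin N`). [cite: JozsaMiyake2008, Thm 1 (i)] -/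
theorem exists_gate_of_isNearestNeighbour {N : ℕ} {q : QGate (gateSet Op M) N} (hq : Matchgate.IsNearestNeighbour q) :
    ∃ (g : Op) (e : Fin 2 ↪ Fin N), IsAdj e ∧ q = QGate.gate g e := by
  cases q with
  | gate g e => exact ⟨g, e, hq, rfl⟩
  | oracle k e => exact absurd hq id

/-- One gate of the fold on the data of a nearest-neighbour gate symbol. [folklore] -/
theorem stepD_gdOf_gate {N : ℕ} (look : ℕ → Bool → ℕ → Matrix LIdx LIdx ℚ) (P : ℕ) (g : Op) {e : Fin 2 ↪ Fin N}
    (h : IsAdj e) (acc : List ℚ × List ℚ) :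
    stepD look P (gateDataOf (QGate.gate g e : QGate (gateSet Op M) N)) acc =
      (stepL (base e) (look (Encodable.encode g) (orBit e) P) acc.1,
        stepL (base e) (look (Encodable.encode g) (orBit e) P) acc.2) := by
  have hadj : isAdjD (gateDataOf (QGate.gate g e : QGate (gateSet Op M) N)) = true := by
    unfold IsAdj at h
    simp [isAdjD, gateDataOf, wiresOf, wire0, wire1, h]
  rw [stepD, if_pos hadj]
  rfl

/-- The rational step of a gate: block base and table block. [folklore] -/
noncomputable def qstep {N : ℕ} (look : ℕ → Bool → ℕ → Matrix LIdx LIdx ℚ) (P : ℕ) :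
    QGate (gateSet Op M) N → ℕ × Matrix LIdx LIdx ℚ
  | .gate g e => (base e, look (Encodable.encode g) (orBit e) P)
  | .oracle _ _ => (0, 0)

/-- **On a nearest-neighbour gate list the machine's fold is the pair of list folds** of part III.
[cite: JozsaMiyake2008, §4 eq. (8)] -/
theorem rowsFold_eq_foldL {N : ℕ} (look : ℕ → Bool → ℕ → Matrix LIdx LIdx ℚ) (P : ℕ) (gs : List (QGate (gateSet Op M) N))
    (hnn : ∀ q ∈ gs, Matchgate.IsNearestNeighbour q) :
    rowsFold look (P, N) (gs.map gateDataOf).reverse =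
      (foldL (gs.map (qstep look P)) (unitL N false), foldL (gs.map (qstep look P)) (unitL N true)) := by
  rw [rowsFold, List.foldl_reverse]
  dsimp only
  induction gs with
  | nil => rfl
  | cons q gs ih =>
    rw [List.map_cons, List.foldr_cons, ih (fun q' hq' => hnn q' (List.mem_cons_of_mem q hq')), List.map_cons]
    obtain ⟨g, e, he, rfl⟩ := exists_gate_of_isNearestNeighbour (hnn _ List.mem_cons_self)
    rw [stepD_gdOf_gate look P g he]
    rfl

/-- Blocks of the rational steps fit in the register. [folklore] -/
theorem qstep_fst_le {N : ℕ} (look : ℕ → Bool → ℕ → Matrix LIdx LIdx ℚ) (P : ℕ) {gs : List (QGate (gateSet Op M) N)}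
    (hnn : ∀ q ∈ gs, Matchgate.IsNearestNeighbour q) : ∀ t ∈ gs.map (qstep look P), t.1 + 2 ≤ N := by
  intro t ht
  obtain ⟨q, hq, rfl⟩ := List.mem_map.1 ht
  obtain ⟨g, e, he, rfl⟩ := exists_gate_of_isNearestNeighbour (hnn _ hq)
  exact base_add_two_le he

/-- **The abstract steps of a gate**: block base, EXACT block (rotation of the local gate) and
approximate block (the table). [cite: JozsaMiyake2008, §4 eq. (8)] -/
noncomputable def usOf {N : ℕ} (look : ℕ → Bool → ℕ → Matrix LIdx LIdx ℚ) (P : ℕ) : QGate (gateSet Op M) N → AStep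
  | .gate g e => (base e, rotOf (localGate (M g) e), (look (Encodable.encode g) (orBit e) P).map (Rat.cast : ℚ → ℝ))
  | .oracle _ _ => (0, 1, (0 : Matrix LIdx LIdx ℚ).map (Rat.cast : ℚ → ℝ))

/-- The approximate blocks of the abstract steps are the table blocks. [folklore] -/
theorem map_usOf {N : ℕ} (look : ℕ → Bool → ℕ → Matrix LIdx LIdx ℚ) (P : ℕ) (gs : List (QGate (gateSet Op M) N)) :
    (gs.map (usOf look P)).map (fun u => (u.1, u.2.2)) =
      (gs.map (qstep look P)).map (fun t => (t.1, t.2.map (Rat.cast : ℚ → ℝ))) := by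
  rw [List.map_map, List.map_map]
  exact List.map_congr_left fun q _ => by cases q <;> rfl

/-- **The exact fold of the abstract steps is the exact row `rowVec`** of part II. [cite: JozsaMiyake2008, §4 eq. (8)] -/
theorem exactFold_usOf {N : ℕ} (look : ℕ → Bool → ℕ → Matrix LIdx LIdx ℚ) (P : ℕ) (p : MIdx N)
    {gs : List (QGate (gateSet Op M) N)} (hnn : ∀ q ∈ gs, Matchgate.IsNearestNeighbour q) :
    exactFold (Pi.single p 1) (gs.map (usOf look P)) = rowVec p gs := by
  induction gs with
  | nil => rfl
  | cons q gs ih =>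
    rw [List.map_cons, exactFold_cons, ih (fun q' hq' => hnn q' (List.mem_cons_of_mem q hq')), rowVec]
    obtain ⟨g, e, -, rfl⟩ := exists_gate_of_isNearestNeighbour (hnn _ List.mem_cons_self)
    rfl

/-- **The abstract steps are good at precision `P`**: blocks fit, exact blocks are orthogonal,
table blocks are `2^{-P}`-accurate. [cite: JozsaMiyake2008, Thm 3] -/
theorem goodSteps_usOf {N : ℕ} (hM : ∀ g, IsMatchgate (M g)) (nm : Names M) (P : ℕ)
    {gs : List (QGate (gateSet Op M) N)} (hnn : ∀ q ∈ gs, Matchgate.IsNearestNeighbour q) :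
    GoodSteps N ((1 / 2 : ℝ) ^ P) (gs.map (usOf (lookOf nm) P)) := by
  intro u hu
  obtain ⟨q, hq, rfl⟩ := List.mem_map.1 hu
  obtain ⟨g, e, h, rfl⟩ := exists_gate_of_isNearestNeighbour (hnn _ hq)
  · refine ⟨base_add_two_le h, ((hM g).localGate e).rotOf_mul_transpose, fun μ ν => ?_⟩
    show |((lookOf nm (Encodable.encode g) (orBit e) P).map (Rat.cast : ℚ → ℝ)) μ ν -
      rotOf (localGate (M g) e) μ ν| ≤ (1 / 2 : ℝ) ^ P
    rw [Matrix.map_apply, lookOf_encode, localGate_eq_locGate g h, abs_sub_comm]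
    have := nm.close g (orBit e) μ ν P
    convert this using 3
    push_cast; ring

/-- **The precision `P = k + T + 8` is enough**: `8 · 2^{-P} · T ≤ 1` and `3 · (8 · 2^{-P} · T) ≤ 2^{-(k+1)}`.
[folklore] -/
theorem prec_bounds (k T : ℕ) :
    8 * (1 / 2 : ℝ) ^ (k + T + 8) * T ≤ 1 ∧ 3 * (8 * (1 / 2 : ℝ) ^ (k + T + 8) * T) ≤ (1 / 2 : ℝ) ^ (k + 1) := by
  have hT : (T : ℝ) ≤ 2 ^ T := by exact_mod_cast (Nat.lt_two_pow_self).le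
  have h2 : (0 : ℝ) < 2 ^ (k + 1) := by positivity
  have h3 : (0 : ℝ) < 2 ^ T := by positivity
  have e : (1 / 2 : ℝ) ^ (k + T + 8) = 1 / (2 ^ (k + 1) * 2 ^ T * 2 ^ 7) := by
    rw [one_div_pow, show k + T + 8 = (k + 1) + T + 7 by ring, pow_add, pow_add]
  have e1 : (1 / 2 : ℝ) ^ (k + 1) = 1 / 2 ^ (k + 1) := one_div_pow _ _
  rw [e, e1]
  constructor
  · rw [mul_one_div, div_mul_eq_mul_div, div_le_one (by positivity)]
    have : (1 : ℝ) ≤ 2 ^ (k + 1) := one_le_pow₀ (by norm_num)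
    nlinarith
  · rw [mul_one_div, div_mul_eq_mul_div, ← mul_div_assoc, div_le_div_iff₀ (by positivity) h2]
    nlinarith

/-- The padded input register read as the list of input bits. [folklore] -/
theorem padInput_eq_getD {n : ℕ} (x : QReg n) (m : ℕ) (i : Fin (n + m)) :
    padInput x m i = (List.ofFn x).getD i false := by
  rw [List.getD_eq_getElem?_getD, List.getElem?_ofFn]
  unfold padInput
  refine Fin.addCases (fun j => ?_) (fun j => ?_) i
  · rw [Fin.append_left, dif_pos (by simp)]; rfl
  · rw [Fin.append_right, dif_neg (by simp)]; rfl

/-- Casting the unit start vector. [folklore] -/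
theorem cast_single {N : ℕ} (p : MIdx N) : (fun q => (((Pi.single p (1 : ℚ) : MIdx N → ℚ) q : ℚ) : ℝ)) = Pi.single p 1 := by
  funext q
  by_cases h : q = p
  · subst h; simp
  · simp [Pi.single_eq_of_ne h]

/-- The unit start vector has norm `1`. [folklore] -/
theorem vnorm_single {N : ℕ} (p : MIdx N) : vnorm (Pi.single p (1 : ℝ)) = 1 :=
  vnorm_eq_one_of_dotProduct (by simp)

/-- **Correctness of the program on a nearest-neighbour instance**: its output is a
`2^{-k}`-approximation of the wire-`0` acceptance probability. [cite: JozsaMiyake2008, Thm 1] -/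
theorem est_spec (hM : ∀ g, IsMatchgate (M g)) (nm : Names M) (i : Instance Op M) (hnn : i.IsNearestNeighbour) :
    |(estV (lookOf nm) (viewOf i) : ℝ) / 2 ^ i.k - i.acceptProb| ≤ (1 / 2 : ℝ) ^ i.k := by
  obtain ⟨n, m, circ, x, k⟩ := i
  simp only [Instance.IsNearestNeighbour] at hnn
  simp only [Instance.acceptProb]
  have hw : wiresV (viewOf (⟨n, m, circ, x, k⟩ : Instance Op M)) = n + m := by simp [wiresV, viewOf]
  by_cases hN : n + m = 0
  · -- the empty register: the program outputs `0`, the acceptance probability is `0`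
    have h0 : estV (lookOf nm) (viewOf (⟨n, m, circ, x, k⟩ : Instance Op M)) = 0 := by rw [estV, if_pos (hw.trans hN)]
    have hacc : circ.acceptProb 0 x = 0 := by
      unfold QCircuit.acceptProb
      exact sum_eq_zero fun y _ => by rw [dif_neg (by omega)]
    rw [h0, hacc]; simp
  · have hN' : 0 < n + m := Nat.pos_of_ne_zero hN
    set P := k + circ.gates.length + 8 with hP
    set look := lookOf nm with hlook
    set w0 : Fin (n + m) := ⟨0, hN'⟩ with hw0
    have hp : precV (viewOf (⟨n, m, circ, x, k⟩ : Instance Op M)) = P := by simp [precV, viewOf, hP]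
    have hest : estV look (viewOf (⟨n, m, circ, x, k⟩ : Instance Op M)) =
        roundEst k (zExpL (List.ofFn x) (foldL (circ.gates.map (qstep look P)) (unitL (n + m) false))
          (foldL (circ.gates.map (qstep look P)) (unitL (n + m) true)) (n + m)) := by
      rw [estV, if_neg (by rw [hw]; exact hN), hp, hw]
      simp only [viewOf]
      rw [rowsFold_eq_foldL look P circ.gates hnn]
    -- the rows lay out the rational folds
    have hrep : ∀ b : Bool, Represents (foldL (circ.gates.map (qstep look P)) (unitL (n + m) b))
        (qFold (Pi.single (w0, b) (1 : ℚ)) (circ.gates.map (qstep look P))) := fun b =>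
      (represents_unitL hN' b).foldL (qstep_fst_le look P hnn)
    -- the read-out is `zExp` of the approximate real rows
    set us := circ.gates.map (usOf look P) with hus
    have hcast : ∀ b : Bool, (fun q => ((qFold (Pi.single (w0, b) (1 : ℚ)) (circ.gates.map (qstep look P)) q : ℚ) : ℝ)) =
        approxFold (Pi.single (w0, b) 1) us := fun b => by
      rw [cast_qFold _ _ us (map_usOf look P circ.gates), cast_single]
    have hz : ((zExpL (List.ofFn x) (foldL (circ.gates.map (qstep look P)) (unitL (n + m) false))
        (foldL (circ.gates.map (qstep look P)) (unitL (n + m) true)) (n + m) : ℚ) : ℝ) =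
        zExp (padInput x m) (approxFold (Pi.single (w0, false) 1) us) (approxFold (Pi.single (w0, true) 1) us) := by
      rw [zExpL_eq_zExp (hrep false) (hrep true) (List.ofFn x) (padInput x m) (padInput_eq_getD x m), hcast, hcast]
    -- the exact rows and the acceptance probability
    have hexact : ∀ b : Bool, exactFold (Pi.single (w0, b) 1) us = rowVec (w0, b) circ.gates := fun b =>
      exactFold_usOf look P (w0, b) hnn
    have hacc : circ.acceptProb 0 x = (1 - zExp (padInput x m) (exactFold (Pi.single (w0, false) 1) us)
        (exactFold (Pi.single (w0, true) 1) us)) / 2 := by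
      rw [hexact, hexact]; exact acceptProb_eq hM circ hnn x hN'
    -- the error analysis
    have hgood : GoodSteps (n + m) ((1 / 2 : ℝ) ^ P) us := goodSteps_usOf hM nm P hnn
    obtain ⟨hlen, hprec⟩ := prec_bounds k circ.gates.length
    have hη : (0 : ℝ) ≤ (1 / 2) ^ P := by positivity
    have hT : us.length = circ.gates.length := List.length_map _
    have herr : ∀ b : Bool, vnorm (approxFold (Pi.single (w0, b) 1) us - exactFold (Pi.single (w0, b) 1) us) ≤
        8 * (1 / 2 : ℝ) ^ P * circ.gates.length := fun b => by
      have := vnorm_approxFold_sub_exactFold_le hη (vnorm_single (w0, b)) hgood (by rw [hT, hP]; exact hlen)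
      rwa [hT] at this
    have hZ : |zExp (padInput x m) (approxFold (Pi.single (w0, false) 1) us) (approxFold (Pi.single (w0, true) 1) us) -
        zExp (padInput x m) (exactFold (Pi.single (w0, false) 1) us) (exactFold (Pi.single (w0, true) 1) us)| ≤
        (1 / 2 : ℝ) ^ (k + 1) := by
      refine (abs_zExp_sub_zExp_le' (padInput x m) ?_ ?_ (herr false) (herr true) (hP ▸ hlen)).trans (hP ▸ hprec)
      · rw [vnorm_exactFold hgood, vnorm_single]
      · rw [vnorm_exactFold hgood, vnorm_single]
    rw [hest]
    exact abs_roundEst_le k hacc (by rw [hz]; exact hZ)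

end correctness

/-! ### The theorem -/

/-- **Discharge of `JozsaMiyake2008_thm1`** (Jozsa–Miyake 2008, Theorem 1, for computational-basis
inputs and the wire-`0` output, finite alphabet of allowable matchgates with polynomial-time
computable entries): the wire-`0` acceptance probability of a nearest-neighbour matchgate circuit
is computable to `k` bits in time polynomial in the length of the instance code. The machine is the
typed program `estV` of part IV on the dyadic names of the `SO(4)` blocks (`lookOf`); its
correctness is the Clifford-algebra calculus of parts I–II plus the error analysis of part III.
[cite: JozsaMiyake2008, Thm 1] -/
theorem JozsaMiyake2008_thm1_holds : JozsaMiyake2008_thm1 := by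
  intro Op _ _ M hM hE
  obtain ⟨nm⟩ := nonempty_names hE
  refine ⟨fun i => estV (lookOf nm) (viewOf i), ?_, fun i hi => est_spec hM nm i hi⟩
  obtain ⟨f, hf, hspec⟩ := codeFP_estV (lookFP_lookOf nm) (lookBound_lookOf hM nm)
  have h : CodeFP Instance.encode smE (fun i : Instance Op M => estV (lookOf nm) (viewOf i)) :=
    ⟨f, hf, fun i => by rw [encode_eq_viewE]; exact hspec (viewOf i)⟩
  exact h.polyTimeComputable

end Literature.Computability.QuantumComplexity.Matchgate
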